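import Summits.BirchSwinnertonDyer.BirchSwinnertonDyer.Theorems.PrintCf2RamifiedOffTYZSquareSilenceSixPQ
import Literature.NumberTheory.EllipticCurves.TianYuanZhang2017.CMPointFrobeniusTwoValueDisplays
import HarnessLib

/-!
# Crux `PrintCf2.RamifiedOffTYZOfFacts` (stmt-BirchSwinnertonDyer-20509), line `offtyz-v7`, LEAD cycle 13 (cruxlead-20509 g12):
# THE FIRST CELL WITH AN ODD COMPOSITE CM BLOCK `≡ 5 (mod 8)` — `n = 2rpq`, `r ≡ 3 (mod 4)`, `p ≡ 1 (mod 8)`, `q ≡ 5 (mod 8)`, `(−r/p) = (q/p) = 1`: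
# the conductor-`2` Frobenius class display (ty2 p736109) supplies the witness `φ_p` on the block `pq ≡ 5 (mod 8)`

THEOREMS ONLY (no `def`, no named fact, no `sorry`), `--supports stmt-BirchSwinnertonDyer-20509` (item 23431 = C⁺, even three-prime sectors).

The divisors of `n = 2rpq` here: `≡ 6 (mod 8)` exactly `2r, 2rp, 2rq, n`; `≡ 5 (mod 8)` exactly `q` and the COMPOSITE block `pq`.  One Frobenius element
does all the work: `φ_p` (`p ≡ 1 (mod 8)`, Euler symbols `(−1/p) = (−2/p) = (−r/p) = (−q/p) = 1`) is trivial on `L_D(i)` for every block `D ∋ p` and is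
non-trivial on `H_D` ((F5): `[𝔭_p] ≠ 1` in `Cl(𝒪_{K_D})`, conductor `4` on `D = n, 2rp` — g39's display — and conductor `2` on `D = pq` — ty2's p736109
`FrobeniusTwoValueBlockSpec` / `exists_frobenius_not_mem_of_clauses₂`); the block `2rq` enters only with the even coefficient `|𝓛(p)|` (`p ≡ 1 (mod 8)`),
`2r` is of the free shape `2·prime`, `q` is prime.  Hence the coefficient-aware square silence (p735302) and the even door give the LOWER HALF of C⁺.
§1 is a reusable witness toolkit: an automorphism fixing `i` and `√−p` for every prime `p ∣ D` is trivial on `L_D(i)` (induction on the divisor), the own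
prime `q` of a Frobenius `φ_q` is recovered from `√−D` and the cofactor (square-freeness), so **a displayed `φ_q` with `q ≡ 1 (mod 4)` and all other Euler
symbols `+1` on the primes of `D` is `L_D(i)`-trivial** (`trivialOnL_of_frobenius_display`).
* `apply_sqrtNeg_eq_of_fix_primes`, `trivialOnL_of_fix_primes`, `trivialOnL_of_fix_primes_ne`, `trivialOnL_of_frobenius_display` (toolkit);
* `prime_dvd_two_rpq`, `divisors_two_rpq_five` (bookkeeping);
* `two_dvd_scriptL_two_rpq_five_of_valuePrinted₂`, ★ **`two_dvd_scriptL_two_rpq_five_of_facts :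
  (tyz_cmPointRingClassFrobeniusValueData₂ ∧ thm11_parity_of_scriptL ∧ GZK) → ∀ n r p q, … → ∀ L, IsScriptL n L → 2 ∣ L`**.
Monsky: `s(n) = 3` on the cell (even matrix of `(r, p, q)` of rank `3`; LEAD computation, crux workfile `Lines/offtyz_v7_EvenTwoPrimes.md`).
Beyond-print theorem: YES (conditional on the three named facts).  BSD is not proved by any of this; no class is closed by this file.

References: [cite: TianYuanZhang2017, Thm. 1.1, §1 (p0002 L101–L110), §3.1 (p0011 L1–L73), Prop. 3.2 (1)(2), Thm. 3.5, Thm. 3.6 (1)(2), Lemma 3.18,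
proof of Lemma 3.21 (p0020 L27–L63)]; [cite: Cox2013, §5.C Lemma 5.19, (5.20), (5.22), Thm. 5.23, Cor. 5.25, §9.A]; [cite: HeathBrown1994SelmerCongruentII,
§1, Appendix (Monsky)]; [cite: Darmon2004, Thm. 3.22].
-/

noncomputable section

open scoped Classical

open WeierstrassCurve WeierstrassCurve.Affine Finset Literature.NumberTheory.EllipticCurves
  Literature.NumberTheory.EllipticCurves.TianYuanZhang2017
  Literature.NumberTheory.EllipticCurves.TianYuanZhang2017.W2
  Summit.BirchSwinnertonDyer.Rank1Residual.P2.GenusPeriodTransferLayer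
  Summit.BirchSwinnertonDyer.Rank1Residual.P2
  Summit.BirchSwinnertonDyer.PrintCf2.MoverAssembly
  Summit.BirchSwinnertonDyer.PrintCf2.SquareSilenceEven
  Summit.BirchSwinnertonDyer.PrintCf2.SquareSilenceCoefficients
  Summit.BirchSwinnertonDyer.PrintCf2.LowerHalfTwoPrimesEvenDisplays
  Summit.BirchSwinnertonDyer.PrintCf2.SixPQ

set_option autoImplicit false

namespace Summit.BirchSwinnertonDyer.PrintCf2.TwoRPQFive

variable {n : ℕ} (D : GenusPointData n)

/-! ## §1 Witness toolkit: fixing the prime radicals suffices; a displayed Frobenius with all Euler symbols `+1` is `L_D(i)`-trivial -/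

/-- An automorphism fixing `i` and `√−p` for every prime `p ∣ d` fixes `√−d` (`1 < d ∣ n`): induction on `d` through `√−a·√−b = ±i·√−(ab)`.
[cite: TianYuanZhang2017, §3.1 (p0011 L60–L66), proof of Lemma 3.21 (p0020 L55–L58)] -/
theorem apply_sqrtNeg_eq_of_fix_primes (hn0 : n ≠ 0) {g : D.H ≃ₐ[ℚ] D.H} (hgi : g D.im = D.im) :
    ∀ d : ℕ, d ∣ n → 1 < d → (∀ p : ℕ, p.Prime → p ∣ d → g (D.sqrtNeg p) = D.sqrtNeg p) →
      g (D.sqrtNeg d) = D.sqrtNeg d := by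
  intro d
  induction d using Nat.strong_induction_on with
  | _ d ih =>
    intro hdn hd1 hfix
    have hmem : ∀ {a : ℕ}, a ∣ n → a ∈ n.divisors := fun ha => Nat.mem_divisors.mpr ⟨ha, hn0⟩
    have hP : d.minFac.Prime := Nat.minFac_prime (by omega)
    have hgP : g (D.sqrtNeg d.minFac) = D.sqrtNeg d.minFac := hfix _ hP (Nat.minFac_dvd d)
    obtain ⟨m, hm⟩ := Nat.minFac_dvd d
    by_cases hm1 : m = 1
    · rw [hm1, mul_one] at hm
      rw [hm]
      exact hgP
    · have hm0 : m ≠ 0 := by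
        rintro rfl
        rw [mul_zero] at hm
        omega
      have hmd : m ∣ d := Dvd.intro_left _ hm.symm
      have hlt : m < d := by
        have h2 : 2 * m ≤ d.minFac * m := Nat.mul_le_mul_right m hP.two_le
        omega
      have hgm : g (D.sqrtNeg m) = D.sqrtNeg m :=
        ih m hlt (hmd.trans hdn) (by omega) fun p hp hpm => hfix p hp (hpm.trans hmd)
      have key := apply_sqrtNeg_mul_eq D (hmem ((Nat.minFac_dvd d).trans hdn)) (hmem (hmd.trans hdn))
        (hmem (by rw [← hm]; exact hdn)) hgi hgP hgm
      rw [← hm] at key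
      exact key

/-- **An automorphism fixing `i` and `√−p` for every prime `p ∣ d` is trivial on `L_d(i)`** (`d ∣ n`).
[cite: TianYuanZhang2017, proof of Lemma 3.21 (p0020 L55–L58)] -/
theorem trivialOnL_of_fix_primes (hn0 : n ≠ 0) {d : ℕ} (hd : d ∣ n) {g : D.H ≃ₐ[ℚ] D.H} (hgi : g D.im = D.im)
    (hfix : ∀ p : ℕ, p.Prime → p ∣ d → g (D.sqrtNeg p) = D.sqrtNeg p) : D.TrivialOnL d g :=
  ⟨hgi, fun d' hd' hd1 => apply_sqrtNeg_eq_of_fix_primes D hn0 hgi d' ((Nat.dvd_of_mem_divisors hd').trans hd) hd1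
    fun p hp hpd => hfix p hp (hpd.trans (Nat.dvd_of_mem_divisors hd'))⟩

/-- **The own prime comes for free**: for square-free `n`, `q ∣ d ∣ n` prime, an automorphism fixing `i`, `√−d` and `√−p` for every prime `p ∣ d`,
`p ≠ q`, also fixes `√−q` (from `√−d` and the cofactor `√−(d/q)`), hence is trivial on `L_d(i)`.
[cite: TianYuanZhang2017, §3.1 (p0011 L60–L66), proof of Lemma 3.21 (p0020 L55–L58)] -/
theorem trivialOnL_of_fix_primes_ne (hsq : Squarefree n) {d q : ℕ} (hd : d ∣ n) (hq : q.Prime) (hqd : q ∣ d)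
    {g : D.H ≃ₐ[ℚ] D.H} (hgi : g D.im = D.im) (hgd : g (D.sqrtNeg d) = D.sqrtNeg d)
    (hfix : ∀ p : ℕ, p.Prime → p ∣ d → p ≠ q → g (D.sqrtNeg p) = D.sqrtNeg p) : D.TrivialOnL d g := by
  have hn0 : n ≠ 0 := hsq.ne_zero
  have hmem : ∀ {a : ℕ}, a ∣ n → a ∈ n.divisors := fun ha => Nat.mem_divisors.mpr ⟨ha, hn0⟩
  obtain ⟨m, hm⟩ := id hqd
  have hmd : m ∣ d := Dvd.intro_left q hm.symm
  have hqm : ¬ q ∣ m := fun h => by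
    have h2 : q * q ∣ n := by
      rw [hm] at hd
      exact (mul_dvd_mul_left q h).trans hd
    exact hq.one_lt.ne' (Nat.isUnit_iff.mp (hsq q h2))
  have hgq : g (D.sqrtNeg q) = D.sqrtNeg q := by
    by_cases hm1 : m = 1
    · rw [hm, hm1, mul_one] at hgd
      exact hgd
    · have hm0 : m ≠ 0 := by
        rintro rfl
        rw [mul_zero] at hm
        rw [hm] at hd
        exact hn0 (Nat.eq_zero_of_zero_dvd hd)
      have hgm : g (D.sqrtNeg m) = D.sqrtNeg m :=
        apply_sqrtNeg_eq_of_fix_primes D hn0 hgi m (hmd.trans hd) (by omega) fun p hp hpm =>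
          hfix p hp (hpm.trans hmd) (by rintro rfl; exact hqm hpm)
      have hmq : g (D.sqrtNeg (m * q)) = D.sqrtNeg (m * q) := by
        rw [mul_comm, ← hm]
        exact hgd
      exact apply_sqrtNeg_eq_of_mul D (hmem (hmd.trans hd)) (hmem (hqd.trans hd)) (hmem (by rw [mul_comm, ← hm]; exact hd))
        hgi hgm hmq
  exact trivialOnL_of_fix_primes D hn0 hd hgi fun p hp hpd => by
    by_cases hpq : p = q
    · rw [hpq]; exact hgq
    · exact hfix p hp hpd hpq

/-- **A displayed Frobenius element `φ_q` with all Euler symbols `+1` is trivial on `L_d(i)`**: `q ∣ d ∣ n` prime (`n` square-free), `φ_q(√−d) = √−d`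
(F1), `φ_q(i) = (−1/q)·i` and `φ_q(√−p) = (−p/q)·√−p` for the primes `p ∣ n`, `p ≠ q` (F3); if `(−1/q) = 1` and `(−p/q) = 1` for every prime `p ∣ d`,
`p ≠ q`, then `φ_q` is trivial on `L_d(i)`. [cite: TianYuanZhang2017, §3.1 (p0011 L60–L66), Prop. 3.2 (1)(2)] [cite: Cox2013, §5.C (5.20), (5.22)] -/
theorem trivialOnL_of_frobenius_display (hsq : Squarefree n) {d q : ℕ} (hd : d ∣ n) (hq : q.Prime) (hqd : q ∣ d)
    (hsym1 : jacobiSym (-1) q = 1) (hsym : ∀ p : ℕ, p.Prime → p ∣ d → p ≠ q → jacobiSym (-(p : ℤ)) q = 1)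
    {φ : D.H ≃ₐ[ℚ] D.H} (hF1 : φ (D.sqrtNeg d) = D.sqrtNeg d) (hFi : φ D.im = (jacobiSym (-1) q) • D.im)
    (hFr : ∀ r : ℕ, r.Prime → r ∣ n → r ≠ q → φ (D.sqrtNeg r) = (jacobiSym (-(r : ℤ)) q) • D.sqrtNeg r) :
    D.TrivialOnL d φ := by
  have hgi : φ D.im = D.im := by rw [hFi, hsym1, one_smul]
  exact trivialOnL_of_fix_primes_ne D hsq hd hq hqd hgi hF1 fun p hp hpd hne => by
    rw [hFr p hp (hpd.trans hd) hne, hsym p hp hpd hne, one_smul]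

/-! ## §2 Divisors of `2rpq`, `r ≡ 3 (mod 4)`, `p ≡ 1 (mod 8)`, `q ≡ 5 (mod 8)` -/

/-- The prime divisors of `2rpq`. -/
theorem prime_dvd_two_rpq {r p q p' : ℕ} (hr : r.Prime) (hp : p.Prime) (hq : q.Prime) (hp' : p'.Prime) (h : p' ∣ 2 * r * p * q) :
    p' = 2 ∨ p' = r ∨ p' = p ∨ p' = q := by
  rcases (Nat.Prime.dvd_mul hp').mp h with h | h
  · rcases (Nat.Prime.dvd_mul hp').mp h with h | h
    · rcases (Nat.Prime.dvd_mul hp').mp h with h | h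
      · exact Or.inl ((Nat.prime_dvd_prime_iff_eq hp' Nat.prime_two).mp h)
      · exact Or.inr (Or.inl ((Nat.prime_dvd_prime_iff_eq hp' hr).mp h))
    · exact Or.inr (Or.inr (Or.inl ((Nat.prime_dvd_prime_iff_eq hp' hp).mp h)))
  · exact Or.inr (Or.inr (Or.inr ((Nat.prime_dvd_prime_iff_eq hp' hq).mp h)))

/-- **Residues of the divisors of `2rpq`** (`r ≡ 3 (mod 4)`, `p ≡ 1 (mod 8)`, `q ≡ 5 (mod 8)` primes): a divisor `≡ 5 (mod 8)` is `q` or the composite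
block `pq`; a divisor `≡ 6 (mod 8)` is `2r, 2rp, 2rq` or `2rpq`. [cite: TianYuanZhang2017, §3.1 (p0011 L67–L70)] -/
theorem divisors_two_rpq_five {r p q : ℕ} (hr : Nat.Prime r) (hp : Nat.Prime p) (hq : Nat.Prime q) (hr4 : r % 4 = 3) (hp8 : p % 8 = 1)
    (hq8 : q % 8 = 5) {d : ℕ} (hd : d ∣ 2 * r * p * q) :
    (d % 8 = 5 → d = q ∨ d = p * q) ∧ (d % 8 = 6 → d = 2 * r ∨ d = 2 * r * p ∨ d = 2 * r * q ∨ d = 2 * r * p * q) := by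
  have hd' : d ∣ 2 * (r * p * q) := by rw [show 2 * (r * p * q) = 2 * r * p * q by ring]; exact hd
  have hpq : (p * q) % 8 = 5 := by rw [Nat.mul_mod, hp8, hq8]
  have hrp : (r * p) % 8 = r % 8 := by rw [Nat.mul_mod, hp8, mul_one, Nat.mod_mod]
  have hrq : (r * q) % 8 = (r % 8 * 5) % 8 := by rw [Nat.mul_mod, hq8]
  have hrpq : (r * p * q) % 8 = (r % 8 * 5) % 8 := by rw [Nat.mul_mod, hrp, hq8]
  have hr8 : r % 8 = 3 ∨ r % 8 = 7 := by omega
  rcases SixPQ.dvd_or_two_mul_dvd_of_dvd_two_mul hd' with h | ⟨d', rfl, h⟩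
  · rcases (dvd_mul_three_iff hr hp hq).mp h with rfl | rfl | rfl | rfl | rfl | rfl | rfl | rfl
    · omega
    · omega
    · omega
    · exact ⟨fun _ => Or.inl rfl, by omega⟩
    · omega
    · omega
    · exact ⟨fun _ => Or.inr rfl, by omega⟩
    · omega
  · rcases (dvd_mul_three_iff hr hp hq).mp h with rfl | rfl | rfl | rfl | rfl | rfl | rfl | rfl
    · omega
    · exact ⟨by omega, fun _ => Or.inl rfl⟩
    · omega
    · omega
    · exact ⟨by omega, fun _ => Or.inr (Or.inl (by ring))⟩
    · exact ⟨by omega, fun _ => Or.inr (Or.inr (Or.inl (by ring)))⟩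
    · omega
    · exact ⟨by omega, fun _ => Or.inr (Or.inr (Or.inr (by ring)))⟩

/-! ## §3 The cell theorem for `n = 2rpq`, `q ≡ 5 (mod 8)` -/

/-- **THE LOWER HALF OF C⁺ ON THE CELL `n = 2rpq`** (`r ≡ 3 (4)`, `p ≡ 1 (8)`, `q ≡ 5 (8)`, `(−r/p) = (q/p) = 1`), display shape over
`D.Printed ∧ D.CMPointRingClassFrobeniusValuePrinted₂`: the single witness `φ_p` on the three blocks `n`, `2rp` (conductor `4`) and `pq` (conductor `2`,
the odd composite block), the even coefficient `|𝓛(p)|` on `2rq`, `2r` free, `q` prime; then the coefficient-aware silence and the even door.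
[cite: TianYuanZhang2017, Thm. 1.1, Thm. 3.5, Lemma 3.18, §3.1, Prop. 3.2 (1)(2), Thm. 3.6 (1)(2), proof of Lemma 3.21] [cite: Cox2013, §5.C Cor. 5.25, §9.A] [cite: Darmon2004, Thm. 3.22] -/
theorem two_dvd_scriptL_two_rpq_five_of_valuePrinted₂ (hGZK : rank_eq_analyticRank_of_analyticRank_le_one) (h11 : thm11_parity_of_scriptL)
    (hsq : Squarefree n) {r p q : ℕ} (hr : r.Prime) (hp : p.Prime) (hq : q.Prime) (hn : n = 2 * r * p * q) (hr4 : r % 4 = 3)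
    (hp8 : p % 8 = 1) (hq8 : q % 8 = 5) (hrp : jacobiSym (-(r : ℤ)) p = 1) (hqp : jacobiSym q p = 1)
    (hra : haveI := isElliptic_congruentNumberCurve hsq.ne_zero; (congruentNumberCurve n).analyticRank = 1)
    (D : GenusPointData n) (hPr : D.Printed) (hV : D.CMPointRingClassFrobeniusValuePrinted₂)
    {x y : ℚ} (hxy : (congruentNumberCurve n).toAffine.Nonsingular x y)
    (hgen : haveI := isElliptic_congruentNumberCurve hsq.ne_zero;
      ∀ P, ∃ k : ℤ, IsOfFinAddOrder (P - k • (Point.some x y hxy : (congruentNumberCurve n).toAffine.Point)))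
    (hx : ¬ ∃ r : ℚ, x = r ^ 2 ∨ x = -r ^ 2 ∨ x = n * r ^ 2 ∨ x = -(n * r ^ 2))
    (hx2 : ¬ ∃ r : ℚ, x = 2 * r ^ 2 ∨ x = -(2 * r ^ 2) ∨ x = 2 * n * r ^ 2 ∨ x = -(2 * n * r ^ 2)) :
    ∀ L : ℤ, IsScriptL n L → (2 : ℤ) ∣ L := by
  have hn0 : n ≠ 0 := hsq.ne_zero
  have hnn : n ∈ n.divisors := Nat.mem_divisors_self n hn0
  have hp2 : p ≠ 2 := by omega
  have h6 : n % 8 = 6 := by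
    rw [hn, show 2 * r * p * q = (2 * r) * (p * q) by ring, Nat.mul_mod, Nat.mul_mod p q, hp8, hq8, Nat.mul_mod 2 r]; omega
  have hdvdn : ∀ {d : ℕ}, d ∈ n.divisors → d ∣ 2 * r * p * q := fun hd => hn ▸ Nat.dvd_of_mem_divisors hd
  have hmem : ∀ {d : ℕ}, d ∣ 2 * r * p * q → d ∈ n.divisors := fun hd => Nat.mem_divisors.mpr ⟨by rw [hn]; exact hd, hn0⟩
  have dp : p ∣ n := by rw [hn]; exact ⟨2 * r * q, by ring⟩
  -- Euler symbols of `φ_p`: all `+1`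
  have v1 : jacobiSym (-1) p = 1 := jacobiSym_neg_one_eq_one hp (by omega)
  have hsym : ∀ p' : ℕ, p'.Prime → p' ∣ n → p' ≠ p → jacobiSym (-(p' : ℤ)) p = 1 := by
    intro p' hp' hp'n hne
    rcases prime_dvd_two_rpq hr hp hq hp' (by rw [← hn]; exact hp'n) with rfl | rfl | rfl | rfl
    · rw [show (-((2 : ℕ) : ℤ)) = -2 by norm_num]; exact jacobiSym_neg_two_eq_one hp (by omega)
    · exact hrp
    · exact absurd rfl hne
    · rw [neg_eq_neg_one_mul, jacobiSym.mul_left, v1, one_mul]; exact hqp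
  obtain ⟨hLs, -, hrec, -, h35, -, -, -, h318, -, -⟩ := hPr
  obtain ⟨z, Φ, ΓH, ΓH', σ, θ, c, ρ₂, ρ₄, hc, hb⟩ := hV
  -- a displayed `φ_p` on a block `d ∋ p` is `L_d(i)`-trivial
  have hL : ∀ {d : ℕ}, d ∣ n → p ∣ d → ∀ {φ : D.H ≃ₐ[ℚ] D.H}, φ (D.sqrtNeg d) = D.sqrtNeg d →
      φ D.im = (jacobiSym (-1) p) • D.im →
      (∀ r' : ℕ, r'.Prime → r' ∣ n → r' ≠ p → φ (D.sqrtNeg r') = (jacobiSym (-(r' : ℤ)) p) • D.sqrtNeg r') → D.TrivialOnL d φ :=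
    fun hd hpd _ hF1 hFi hFr => trivialOnL_of_frobenius_display D hsq hd hp hpd v1
      (fun p' hp' hp'd hne => hsym p' hp' (hp'd.trans hd) hne) hF1 hFi hFr
  -- the top witness `φ_p` (conductor 4)
  obtain ⟨φ, hF1, hF2, hFi, hFr, hF5⟩ := D.exists_frobenius_not_mem_of_clauses₂_six hsq hb hnn h6 hp dp hp2
  refine two_dvd_scriptL_of_coefficients_even_of_x_not_mem D hGZK hsq h6 hra hrec h35 hLs h318 z Φ ΓH ΓH' σ c hc
    (fun d hd => ⟨(hb d hd).1, (hb d hd).2.2.1⟩) ⟨φ, hL dvd_rfl dp hF1 hFi hFr, hF2, hF5⟩ (fun d hd hd6 hdn => ?_) (fun d hd hd5 => ?_)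
    hxy hgen hx hx2
  · -- proper even blocks `2r`, `2rp`, `2rq`
    rcases (divisors_two_rpq_five hr hp hq hr4 hp8 hq8 (hdvdn hd)).2 hd6 with rfl | rfl | rfl | rfl
    · exact Or.inl ⟨r, hr, rfl⟩
    · -- `2rp`: the witness `φ_p` (conductor 4)
      obtain ⟨ψ, hG1, hG2, hGi, hGr, hG5⟩ :=
        D.exists_frobenius_not_mem_of_clauses₂_six hsq hb hd hd6 hp (Dvd.intro_left (2 * r) rfl) hp2
      exact Or.inr (Or.inl ⟨ψ, hL (Nat.dvd_of_mem_divisors hd) (Dvd.intro_left (2 * r) rfl) hG1 hGi hGr, hG2, hG5⟩)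
    · -- `2rq`: the even coefficient `|𝓛(p)|`
      refine Or.inr (Or.inr ?_)
      rw [show n / (2 * r * q) = p by
        rw [hn, show 2 * r * p * q = (2 * r * q) * p by ring]; exact Nat.mul_div_cancel_left p (Nat.mul_pos (Nat.mul_pos two_pos hr.pos) hq.pos)]
      exact even_scriptL_of_prime_one_mod_eight h11 D hLs hp hp8 (hmem ⟨2 * r * q, by ring⟩)
    · exact absurd hn.symm hdn
  · -- odd blocks `≡ 5`: `q` prime, `pq` by the witness `φ_p` (conductor 2)
    rcases (divisors_two_rpq_five hr hp hq hr4 hp8 hq8 (hdvdn hd)).1 hd5 with rfl | rfl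
    · exact Or.inl hq
    · have hne : p ≠ p * q := fun h => by
        have h1 : p * q = p * 1 := by rw [mul_one]; exact h.symm
        have := Nat.eq_of_mul_eq_mul_left hp.pos h1
        omega
      obtain ⟨ψ, hG1, hG2, hGi, hGr, hG5⟩ := D.exists_frobenius_not_mem_of_clauses₂ hsq hb hd hd5 hp (Dvd.intro q rfl) hne
      exact Or.inr ⟨ψ, hL (Nat.dvd_of_mem_divisors hd) (Dvd.intro q rfl) hG1 hGi hGr, hG2, hG5⟩

/-- **THE LOWER HALF ON THE CELL `n = 2rpq`, `q ≡ 5 (mod 8)`, FROM THE NAMED FACTS** (`OfFacts` shape, by-name closable):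
`(tyz_cmPointRingClassFrobeniusValueData₂ ∧ thm11_parity_of_scriptL ∧ GZK)` implies — for primes `r ≡ 3 (mod 4)`, `p ≡ 1 (mod 8)`, `q ≡ 5 (mod 8)` with
`(−r/p) = 1`, `(q/p) = 1`, `n = 2rpq` square-free, `ord_{s=1} L(E_n, s) = 1`, and a generator `R = (x, y)` of `E_n(ℚ)` modulo torsion with
`x ∉ {±1, ±2, ±n, ±2n}·ℚ^{×2}` — `2 ∣ L` whenever `𝓛(n)² = L²`.  The first by-name cell whose proof uses a witness on an ODD COMPOSITE block (`pq ≡ 5`).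
[cite: TianYuanZhang2017, Thm. 1.1, §1, §3, Prop. 3.2 (1)(2)] [cite: Cox2013, §5.C Cor. 5.25, §9.A] [cite: HeathBrown1994SelmerCongruentII, §1] [cite: Darmon2004, Thm. 3.22] -/
theorem two_dvd_scriptL_two_rpq_five_of_facts :
    (tyz_cmPointRingClassFrobeniusValueData₂ ∧ thm11_parity_of_scriptL ∧ rank_eq_analyticRank_of_analyticRank_le_one) →
      ∀ n r p q : ℕ, (hsq : Squarefree n) → r.Prime → p.Prime → q.Prime → n = 2 * r * p * q → r % 4 = 3 → p % 8 = 1 → q % 8 = 5 →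
        jacobiSym (-(r : ℤ)) p = 1 → jacobiSym q p = 1 →
        (haveI := isElliptic_congruentNumberCurve hsq.ne_zero; (congruentNumberCurve n).analyticRank = 1) →
        ∀ (x y : ℚ) (hxy : (congruentNumberCurve n).toAffine.Nonsingular x y),
          (haveI := isElliptic_congruentNumberCurve hsq.ne_zero;
            ∀ P, ∃ k : ℤ, IsOfFinAddOrder (P - k • (Point.some x y hxy : (congruentNumberCurve n).toAffine.Point))) →
          (¬ ∃ r : ℚ, x = r ^ 2 ∨ x = -r ^ 2 ∨ x = n * r ^ 2 ∨ x = -(n * r ^ 2)) →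
          (¬ ∃ r : ℚ, x = 2 * r ^ 2 ∨ x = -(2 * r ^ 2) ∨ x = 2 * n * r ^ 2 ∨ x = -(2 * n * r ^ 2)) →
            ∀ L : ℤ, IsScriptL n L → (2 : ℤ) ∣ L := by
  intro h n r p q hsq hr hp hq hn hr4 hp8 hq8 hrp hqp hra x y hxy hgen hx hx2
  have h6 : n % 8 = 6 := by
    rw [hn, show 2 * r * p * q = (2 * r) * (p * q) by ring, Nat.mul_mod, Nat.mul_mod p q, hp8, hq8, Nat.mul_mod 2 r]; omega
  obtain ⟨D, hPr, hV⟩ := h.1 n hsq (Or.inr (Or.inl h6))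
  exact two_dvd_scriptL_two_rpq_five_of_valuePrinted₂ h.2.2 h.2.1 hsq hr hp hq hn hr4 hp8 hq8 hrp hqp hra D hPr hV hxy hgen hx hx2

end Summit.BirchSwinnertonDyer.PrintCf2.TwoRPQFive

end
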